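import Mathlib
import HarnessLib
import Literature.NumberTheory.LFunctions.ZetaScrew
import Literature.NumberTheory.LFunctions.ZetaScrewThm41Proofs
import Summits.RiemannHypothesis.RiemannHypothesis.Theorems.IntegerScrewHingeCarrier
import Summits.RiemannHypothesis.RiemannHypothesis.Theorems.IntegerScrewHingeCovariance

/-!
# Route `IntegerScrew` — `Ψ` is Lipschitz away from `0`, and FAR increment brackets are `O(1/M)`
# (PIVOT-LAW §15.13/§15.14, kernel road (3): the cross terms of the joint arithmetic floor; RH-FREE)

For two increments `I_a`, `I_b` of Kreĭn's screw line with labels `a > b` at a FIXED RATIO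
(`a/M → α`, `b/M → β`, `0 < β < α`) the Gram bracket
`B(a,b) = Ψ(log(a/(b−1))) + Ψ(log((a−1)/b)) − Ψ(log(a/b)) − Ψ(log((a−1)/(b−1)))`
is a second difference of `Ψ` over a lag cell of sides `log(a/(a−1)) ≍ 1/M` and `log(b/(b−1))` near the
lag `ℓ = log(α/β) > 0`, where `Ψ` is Lipschitz; hence `M·B(a,b) = O(1)`:

* `hasDerivWithinAt_zetaScrew_Ici_of_pos` — at every `t > 0`, `Ψ` has the right derivative
  `Ψ₁(t) − Σ_{n ≤ e^t} Λ(n)/√n` (gaps: `IntegerScrewHingeCarrier.hasDerivAt_zetaScrew_of_mem_Ioo`; nodes: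
  `hasDerivWithinAt_zetaScrew_Ici`);
* **`exists_lipschitz_zetaScrew`** — on every `[a, b] ⊂ (0, ∞)`, `|Ψ(y) − Ψ(x)| ≤ K·|y − x|`
  (`K = sup|Ψ₁| + Σ_{n ≤ e^b} Λ(n)/√n`, by the one-sided mean value inequality);
* `abs_fourPoint_le` — `|Ψ(P₁) + Ψ(P₂) − Ψ(P₃) − Ψ(P₄)| ≤ K(|P₁ − P₄| + |P₃ − P₂|)` on `[a,b]`;
* **`eventually_abs_mul_farBracket_le`** — if `a_M/M → α`, `b_M/M → β`, `0 < β < α`, then for some `C`,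
  eventually `|M·B(a_M, b_M)| ≤ C`.

The instances (neighbour `M − k` vs. hinge carrier `⌈M/n⌉`; two carriers `⌈M/n⌉`, `⌈M/n'⌉`) are the
bounded cross terms of `IntegerScrewArithmeticFloor`.  Elementary real analysis on the explicit `Ψ`;
nothing here bears on the truth of RH. [Suzuki2023, (1.1)]
-/

noncomputable section

-- D-0017: `Summit.<S>.<S>.…` is the designed namespace of a single-problem summit.
set_option linter.dupNamespace false

namespace Summit.RiemannHypothesis.RiemannHypothesis.Theorems.IntegerScrew

open Literature.NumberTheory.LFunctions Literature.NumberTheory.LFunctions.Suzuki2023Thm41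
open Filter Set Finset
open scoped Topology

/-! ### The right derivative of `Ψ` at every `t > 0` -/

/-- At every `t > 0`, `Ψ` restricted to `[t, ∞)` is differentiable at `t` with derivative
`Ψ₁(t) − Σ_{n ≤ ⌊e^t⌋} Λ(n)/√n` (in a gap this is the two-sided derivative; at a node `t = log q` it is
the right derivative). [folklore] -/
theorem hasDerivWithinAt_zetaScrew_Ici_of_pos {t : ℝ} (ht : 0 < t) :
    HasDerivWithinAt zetaScrew
      (wallPsi₁ t - ∑ n ∈ Icc 1 ⌊Real.exp t⌋₊, ArithmeticFunction.vonMangoldt n / Real.sqrt n)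
      (Ici t) t := by
  set N := ⌊Real.exp t⌋₊ with hN
  have hexp1 : 1 ≤ Real.exp t := by
    have := Real.add_one_le_exp t; linarith
  have hN1 : 1 ≤ N := by
    rw [hN]; exact Nat.le_floor (by exact_mod_cast hexp1)
  have hN0 : (0 : ℝ) < N := by exact_mod_cast hN1
  have hlogN : Real.log N ≤ t := by
    rw [← Real.log_exp t]
    exact Real.log_le_log hN0 (Nat.floor_le (by positivity))
  have hlt : t < Real.log (N + 1) := by
    rw [← Real.log_exp t]
    refine Real.log_lt_log (Real.exp_pos t) ?_
    have := Nat.lt_floor_add_one (Real.exp t)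
    rw [hN]; exact_mod_cast this
  rcases eq_or_lt_of_le hlogN with heq | hgt
  · -- node: t = log N, N ≥ 2
    have hN2 : 2 ≤ N := by
      by_contra h
      have h1 : N = 1 := by omega
      rw [h1, Nat.cast_one, Real.log_one] at heq
      linarith
    rw [← heq]
    exact hasDerivWithinAt_zetaScrew_Ici hN2
  · exact (hasDerivAt_zetaScrew_of_mem_Ioo hN1 hgt hlt).hasDerivWithinAt

/-! ### `Ψ` is Lipschitz on compact subintervals of `(0, ∞)` -/

/-- **`Ψ` is Lipschitz away from `0`.**  For `0 < a ≤ b` there is `K ≥ 0` with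
`|Ψ(y) − Ψ(x)| ≤ K·|y − x|` for all `x, y ∈ [a, b]` (one-sided mean value inequality with the right
derivative `Ψ₁ − Σ_{n ≤ e^t}Λ(n)/√n`, bounded on `[a,b]` by `sup|Ψ₁| + Σ_{n ≤ e^b}Λ(n)/√n`). [folklore] -/
theorem exists_lipschitz_zetaScrew {a b : ℝ} (ha : 0 < a) (hab : a ≤ b) :
    ∃ K : ℝ, 0 ≤ K ∧ ∀ x ∈ Icc a b, ∀ y ∈ Icc a b,
      |zetaScrew y - zetaScrew x| ≤ K * |y - x| := by
  have hsub : Icc a b ⊆ Ioi 0 := fun x hx => lt_of_lt_of_le ha hx.1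
  obtain ⟨K₁, hK₁⟩ := isCompact_Icc.exists_bound_of_continuousOn
    (continuousOn_wallPsi₁_Ioi.mono hsub)
  set S : ℝ := ∑ n ∈ Icc 1 ⌊Real.exp b⌋₊, ArithmeticFunction.vonMangoldt n / Real.sqrt n with hS
  have hterm : ∀ n : ℕ, 0 ≤ ArithmeticFunction.vonMangoldt n / Real.sqrt n := fun n =>
    div_nonneg ArithmeticFunction.vonMangoldt_nonneg (Real.sqrt_nonneg _)
  have hS0 : 0 ≤ S := Finset.sum_nonneg fun n _ => hterm n
  have hK₁0 : 0 ≤ K₁ := (norm_nonneg _).trans (hK₁ a (left_mem_Icc.2 hab))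
  refine ⟨K₁ + S, by positivity, ?_⟩
  -- the derivative bound on [a, b]
  have hbound : ∀ z ∈ Icc a b,
      ‖wallPsi₁ z - ∑ n ∈ Icc 1 ⌊Real.exp z⌋₊, ArithmeticFunction.vonMangoldt n / Real.sqrt n‖
        ≤ K₁ + S := by
    intro z hz
    refine (norm_sub_le _ _).trans (add_le_add (hK₁ z hz) ?_)
    rw [Real.norm_eq_abs, abs_of_nonneg (Finset.sum_nonneg fun n _ => hterm n)]
    refine Finset.sum_le_sum_of_subset_of_nonneg (Finset.Icc_subset_Icc_right
      (Nat.floor_le_floor (Real.exp_le_exp.2 hz.2))) fun n _ _ => hterm n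
  -- ordered version
  have hord : ∀ x ∈ Icc a b, ∀ y ∈ Icc a b, x ≤ y →
      |zetaScrew y - zetaScrew x| ≤ (K₁ + S) * (y - x) := by
    intro x hx y hy hxy
    have h := norm_image_sub_le_of_norm_deriv_right_le_segment (f := zetaScrew)
      (f' := fun t => wallPsi₁ t - ∑ n ∈ Icc 1 ⌊Real.exp t⌋₊,
        ArithmeticFunction.vonMangoldt n / Real.sqrt n) (a := x) (b := y) (C := K₁ + S)
      continuous_zetaScrew.continuousOn
      (fun z hz => hasDerivWithinAt_zetaScrew_Ici_of_pos (lt_of_lt_of_le ha (hx.1.trans hz.1)))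
      (fun z hz => hbound z ⟨hx.1.trans hz.1, hz.2.le.trans hy.2⟩) y ⟨hxy, le_rfl⟩
    rwa [Real.norm_eq_abs] at h
  intro x hx y hy
  rcases le_total x y with hxy | hyx
  · rw [abs_of_nonneg (sub_nonneg.2 hxy)]
    exact hord x hx y hy hxy
  · rw [abs_sub_comm (zetaScrew y) (zetaScrew x), abs_sub_comm y x,
      abs_of_nonneg (sub_nonneg.2 hyx)]
    exact hord y hy x hx hyx

/-- The four-point (mixed second difference) bound on `[a,b]`:
`|Ψ(P₁) + Ψ(P₂) − Ψ(P₃) − Ψ(P₄)| ≤ K·(|P₁ − P₄| + |P₃ − P₂|)`. [folklore] -/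
theorem abs_fourPoint_le {K a b : ℝ}
    (hK : ∀ x ∈ Icc a b, ∀ y ∈ Icc a b, |zetaScrew y - zetaScrew x| ≤ K * |y - x|)
    {P₁ P₂ P₃ P₄ : ℝ} (h₁ : P₁ ∈ Icc a b) (h₂ : P₂ ∈ Icc a b) (h₃ : P₃ ∈ Icc a b)
    (h₄ : P₄ ∈ Icc a b) :
    |zetaScrew P₁ + zetaScrew P₂ - zetaScrew P₃ - zetaScrew P₄|
      ≤ K * (|P₁ - P₄| + |P₃ - P₂|) := by
  have e : zetaScrew P₁ + zetaScrew P₂ - zetaScrew P₃ - zetaScrew P₄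
      = (zetaScrew P₁ - zetaScrew P₄) - (zetaScrew P₃ - zetaScrew P₂) := by ring
  rw [e, mul_add]
  exact (abs_sub _ _).trans (add_le_add (hK P₄ h₄ P₁ h₁) (hK P₂ h₂ P₃ h₃))

/-! ### Far brackets are `O(1/M)` -/

/-- Eventually (in `M : ℕ`) the real cast exceeds any given real. [folklore] -/
private theorem eventually_natCast_gt'' (c : ℝ) : ∀ᶠ M : ℕ in atTop, c < (M : ℝ) :=
  tendsto_natCast_atTop_atTop.eventually (eventually_gt_atTop c)

/-- **FAR BRACKETS ARE `O(1/M)`.**  Let `a, b : ℕ → ℕ` with `a_M/M → α`, `b_M/M → β`, `0 < β < α`.  Then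
for some constant `C`, eventually in `M`:
`|M·(Ψ(log(a/(b−1))) + Ψ(log((a−1)/b)) − Ψ(log(a/b)) − Ψ(log((a−1)/(b−1))))| ≤ C`
(`a = a_M`, `b = b_M`) — i.e. `M·Cov(I_{a_M}, I_{b_M}) = O(1)`: the bracket is a second difference of
`Ψ` with sides `log(a/(a−1)) ≤ 1/(a−1)` and `log(b/(b−1))` inside `[ℓ/2, 2ℓ]`, `ℓ = log(α/β) > 0`,
where `Ψ` is Lipschitz. [folklore] -/
theorem eventually_abs_mul_farBracket_le (a b : ℕ → ℕ) {α β : ℝ} (hβ : 0 < β) (hαβ : β < α)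
    (ha : Tendsto (fun M : ℕ => (a M : ℝ) / M) atTop (𝓝 α))
    (hb : Tendsto (fun M : ℕ => (b M : ℝ) / M) atTop (𝓝 β)) :
    ∃ C : ℝ, ∀ᶠ M : ℕ in atTop,
      |(M : ℝ) * (zetaScrew (Real.log ((a M : ℝ) / ((b M : ℝ) - 1)))
        + zetaScrew (Real.log (((a M : ℝ) - 1) / (b M : ℝ)))
        - zetaScrew (Real.log ((a M : ℝ) / (b M : ℝ)))
        - zetaScrew (Real.log (((a M : ℝ) - 1) / ((b M : ℝ) - 1))))| ≤ C := by
  have hα : 0 < α := hβ.trans hαβ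
  set ℓ : ℝ := Real.log (α / β) with hℓ
  have hℓ0 : 0 < ℓ := Real.log_pos (by rw [lt_div_iff₀ hβ, one_mul]; exact hαβ)
  obtain ⟨K, hK0, hK⟩ := exists_lipschitz_zetaScrew (a := ℓ / 2) (b := 2 * ℓ) (by linarith)
    (by linarith)
  -- 1/M → 0, hence (a−1)/M → α and (b−1)/M → β
  have hinv : Tendsto (fun M : ℕ => (1 : ℝ) / M) atTop (𝓝 0) :=
    tendsto_const_nhds.div_atTop tendsto_natCast_atTop_atTop
  have ha' : Tendsto (fun M : ℕ => ((a M : ℝ) - 1) / M) atTop (𝓝 α) := by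
    have := ha.sub hinv
    rw [sub_zero] at this
    exact this.congr fun M => by ring
  have hb' : Tendsto (fun M : ℕ => ((b M : ℝ) - 1) / M) atTop (𝓝 β) := by
    have := hb.sub hinv
    rw [sub_zero] at this
    exact this.congr fun M => by ring
  -- the casts tend to +∞; eventually a, b ≥ 2
  have haT : Tendsto (fun M : ℕ => (a M : ℝ)) atTop atTop := by
    refine (ha.pos_mul_atTop hα tendsto_natCast_atTop_atTop).congr' ?_
    filter_upwards [eventually_natCast_gt'' 0] with M hM
    field_simp
  have hbT : Tendsto (fun M : ℕ => (b M : ℝ)) atTop atTop := by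
    refine (hb.pos_mul_atTop hβ tendsto_natCast_atTop_atTop).congr' ?_
    filter_upwards [eventually_natCast_gt'' 0] with M hM
    field_simp
  have ha2 : ∀ᶠ M : ℕ in atTop, (2 : ℝ) ≤ a M := haT.eventually (eventually_ge_atTop 2)
  have hb2 : ∀ᶠ M : ℕ in atTop, (2 : ℝ) ≤ b M := hbT.eventually (eventually_ge_atTop 2)
  -- the four lags tend to ℓ: log(u/v) with u/M → α, v/M → β
  have hlag : ∀ (u v : ℕ → ℝ), Tendsto (fun M : ℕ => u M / M) atTop (𝓝 α) →
      Tendsto (fun M : ℕ => v M / M) atTop (𝓝 β) →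
      (∀ᶠ M : ℕ in atTop, 0 < v M) →
      Tendsto (fun M : ℕ => Real.log (u M / v M)) atTop (𝓝 ℓ) := by
    intro u v hu hv hv0
    have hq : Tendsto (fun M : ℕ => (u M / M) / (v M / M)) atTop (𝓝 (α / β)) := hu.div hv hβ.ne'
    have hq' : Tendsto (fun M : ℕ => u M / v M) atTop (𝓝 (α / β)) := by
      refine hq.congr' ?_
      filter_upwards [eventually_natCast_gt'' 0, hv0] with M hM hvM
      field_simp
    exact (Real.continuousAt_log (by positivity : α / β ≠ 0)).tendsto.comp hq'
  have hmemI : Icc (ℓ / 2) (2 * ℓ) ∈ 𝓝 ℓ := Icc_mem_nhds (by linarith) (by linarith)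
  have hb0 : ∀ᶠ M : ℕ in atTop, (0 : ℝ) < b M := by
    filter_upwards [hb2] with M hM; linarith
  have hb10 : ∀ᶠ M : ℕ in atTop, (0 : ℝ) < (b M : ℝ) - 1 := by
    filter_upwards [hb2] with M hM; linarith
  have hP1 := (hlag (fun M => (a M : ℝ)) (fun M => (b M : ℝ) - 1) ha hb' hb10).eventually hmemI
  have hP2 := (hlag (fun M => (a M : ℝ) - 1) (fun M => (b M : ℝ)) ha' hb hb0).eventually hmemI
  have hP3 := (hlag (fun M => (a M : ℝ)) (fun M => (b M : ℝ)) ha hb hb0).eventually hmemI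
  have hP4 := (hlag (fun M => (a M : ℝ) - 1) (fun M => (b M : ℝ) - 1) ha' hb' hb10).eventually hmemI
  -- M/(a − 1) → 1/α, hence eventually ≤ 2/α
  have hMa : Tendsto (fun M : ℕ => (M : ℝ) / ((a M : ℝ) - 1)) atTop (𝓝 (1 / α)) := by
    have h := ha'.inv₀ hα.ne'
    refine (h.congr' ?_).trans (by rw [one_div])
    filter_upwards [eventually_natCast_gt'' 0] with M hM
    rw [inv_div]
  have hMa2 : ∀ᶠ M : ℕ in atTop, (M : ℝ) / ((a M : ℝ) - 1) ≤ 2 / α :=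
    hMa.eventually (Iic_mem_nhds (by rw [one_div, lt_div_iff₀ hα, inv_mul_cancel₀ hα.ne']; norm_num))
  refine ⟨K * (2 * (2 / α)), ?_⟩
  filter_upwards [hP1, hP2, hP3, hP4, ha2, hb2, hMa2, eventually_natCast_gt'' 0]
    with M h1 h2 h3 h4 haM hbM hMaM hM0
  have ha0 : (0 : ℝ) < a M := by linarith
  have ha1 : (0 : ℝ) < (a M : ℝ) - 1 := by linarith
  have hb0' : (0 : ℝ) < b M := by linarith
  have hb1 : (0 : ℝ) < (b M : ℝ) - 1 := by linarith
  -- the two sides of the lag cell are both log(a/(a−1))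
  have hside : Real.log ((a M : ℝ) / ((b M : ℝ) - 1)) - Real.log (((a M : ℝ) - 1) / ((b M : ℝ) - 1))
      = Real.log ((a M : ℝ) / ((a M : ℝ) - 1)) := by
    rw [Real.log_div ha0.ne' hb1.ne', Real.log_div ha1.ne' hb1.ne', Real.log_div ha0.ne' ha1.ne']
    ring
  have hside' : Real.log ((a M : ℝ) / (b M : ℝ)) - Real.log (((a M : ℝ) - 1) / (b M : ℝ))
      = Real.log ((a M : ℝ) / ((a M : ℝ) - 1)) := by
    rw [Real.log_div ha0.ne' hb0'.ne', Real.log_div ha1.ne' hb0'.ne', Real.log_div ha0.ne' ha1.ne']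
    ring
  have hh0 : 0 ≤ Real.log ((a M : ℝ) / ((a M : ℝ) - 1)) :=
    Real.log_nonneg (by rw [le_div_iff₀ ha1]; linarith)
  have hh1 : Real.log ((a M : ℝ) / ((a M : ℝ) - 1)) ≤ 1 / ((a M : ℝ) - 1) := by
    have := Real.log_le_sub_one_of_pos (show 0 < (a M : ℝ) / ((a M : ℝ) - 1) by positivity)
    have e : (a M : ℝ) / ((a M : ℝ) - 1) - 1 = 1 / ((a M : ℝ) - 1) := by
      field_simp; ring
    linarith [e]
  have h4pt := abs_fourPoint_le hK h1 h2 h3 h4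
  rw [hside, hside', abs_of_nonneg hh0] at h4pt
  rw [abs_mul, abs_of_nonneg hM0.le]
  calc (M : ℝ) * |zetaScrew (Real.log ((a M : ℝ) / ((b M : ℝ) - 1)))
        + zetaScrew (Real.log (((a M : ℝ) - 1) / (b M : ℝ)))
        - zetaScrew (Real.log ((a M : ℝ) / (b M : ℝ)))
        - zetaScrew (Real.log (((a M : ℝ) - 1) / ((b M : ℝ) - 1)))|
      ≤ (M : ℝ) * (K * (Real.log ((a M : ℝ) / ((a M : ℝ) - 1))
          + Real.log ((a M : ℝ) / ((a M : ℝ) - 1)))) :=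
        mul_le_mul_of_nonneg_left h4pt hM0.le
    _ = K * (2 * ((M : ℝ) * Real.log ((a M : ℝ) / ((a M : ℝ) - 1)))) := by ring
    _ ≤ K * (2 * ((M : ℝ) * (1 / ((a M : ℝ) - 1)))) := by gcongr
    _ = K * (2 * ((M : ℝ) / ((a M : ℝ) - 1))) := by rw [mul_one_div]
    _ ≤ K * (2 * (2 / α)) := by gcongr

end Summit.RiemannHypothesis.RiemannHypothesis.Theorems.IntegerScrew

end
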